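import Literature.Claims.NS.Bledsoe2026
import Literature.Analysis.FluidPDE.VorticityCalculus
import Literature.Analysis.FluidPDE.VectorCalculusProofs

/-!
# C86 `Bledsoe2026` — two explicit test fields for the weighted-stretching countermodel (witness module)

Companion (B) of `SoloRefuteBledsoe2026.lean` (row C86, cell `ns-claims`; B. Bledsoe, Zenodo 17116634, §4.4
(2)–(3) p.7, (B.4) p.20). Two smooth compactly supported divergence-free fields on `ℝ³`, in coordinates:
* the **poloidal ring** `w = curl (G(|x|²)(−x₁, x₀, 0)) = (−2x₀x₂G′, −2x₁x₂G′, 2G + 2(x₀²+x₁²)G′)`,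
  `G(t) = t·smoothTransition(2 − 4t)` (`= t` for `t ≤ 1/4`, `= 0` for `t ≥ 1/2`): `div w = 0` (`divergence_w`),
  HORIZONTAL vorticity `(curl w)₂ = 0` (`curl_w_apply_two`), `(curl w)₁ = −x₀(10G′ + 4|x|²G″)`, `w ≡ 0` off
  `|x|² ≤ 1/2` (`fderiv_w_eq_zero`, `curl_w_eq_zero`);
* the **strain cavity** `v = curl (χ · A)`, `A = x₂(x₁, −x₀, 0)`, `χ` a bump `≡ 1` on the unit ball: `div v = 0`
  (`divergence_v`), and on the unit ball `v = D x`, `Dv = D = diag(1, 1, −2)`, `curl v = 0` (`fderiv_v`,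
  `curl_v`); `⟪D b, b⟫ = ‖b‖²` for horizontal `b` (`inner_Dlin_of_horizontal`).
The assembly (`S(v + w) = S(v) + S(w) + ‖curl w‖³_{L³}`, scaling audit, `¬ Step_44_cubicStretchingBound`) is
`SoloRefuteBledsoe2026Stretching.lean`. Refuter of record ns-claims-refuter-4 g0. WHAT THIS IS NOT: not a
claim about NS regularity or blow-up; not a claim about any author beyond the typed locator.
-/

set_option linter.dupNamespace false

noncomputable section

open Set MeasureTheory Filter Topology
open scoped RealInnerProductSpace ContDiff

namespace Summit.NavierStokesRegularity.NavierStokesRegularity.Theorems.Bledsoe2026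

open Literature.Claims.NS.Bledsoe2026 Literature.Analysis.FluidPDE

/-- Coordinate maps are smooth. [folklore] -/
theorem contDiff_coord (i : Fin 3) : ContDiff ℝ ∞ (fun x : E3 => x i) :=
  contDiff_euclidean.1 contDiff_id i

/-- Derivative of a coordinate map. [folklore] -/
private theorem hasFDerivAt_coord (i : Fin 3) (x : E3) :
    HasFDerivAt (fun y : E3 => y i) (EuclideanSpace.proj i : E3 →L[ℝ] ℝ) x :=
  (EuclideanSpace.proj i : E3 →L[ℝ] ℝ).hasFDerivAt

/-- Components of the Fréchet derivative are derivatives of the components. [folklore] -/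
theorem fderiv_apply_coord {f : E3 → E3} {x : E3} (hf : DifferentiableAt ℝ f x) (h : E3) (i : Fin 3) :
    fderiv ℝ f x h i = fderiv ℝ (fun y => f y i) x h := by
  have := ((EuclideanSpace.proj i : E3 →L[ℝ] ℝ).hasFDerivAt.comp x hf.hasFDerivAt).fderiv
  rw [show (fun y => f y i) = (EuclideanSpace.proj i : E3 →L[ℝ] ℝ) ∘ f from rfl, this]
  rfl

/-- `‖x‖² = x₀² + x₁² + x₂²`. [folklore] -/
private theorem normsq_eq (x : E3) : ‖x‖ ^ 2 = x 0 ^ 2 + x 1 ^ 2 + x 2 ^ 2 := by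
  rw [EuclideanSpace.real_norm_sq_eq, Fin.sum_univ_three]

/-- `⟪a, b⟫ = ∑ aᵢbᵢ`. [folklore] -/
private theorem inner_eq3 (a b : E3) : ⟪a, b⟫ = a 0 * b 0 + a 1 * b 1 + a 2 * b 2 := by
  rw [PiLp.inner_apply, Fin.sum_univ_three]; simp [mul_comm]

/-- Derivative of `x ↦ H(‖x‖²)` for `H : ℝ → ℝ`: `H'(‖x‖²) · 2⟪x, ·⟫`. [folklore] -/
theorem hasFDerivAt_radial {H : ℝ → ℝ} {H' : ℝ} {x : E3} (hH : HasDerivAt H H' (‖x‖ ^ 2)) :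
    HasFDerivAt (fun y : E3 => H (‖y‖ ^ 2)) (H' • ((2 : ℕ) • innerSL ℝ x)) x :=
  hH.comp_hasFDerivAt x (hasStrictFDerivAt_norm_sq x).hasFDerivAt

/-- `G t = t · smoothTransition (2 − 4t)`: smooth, `G t = t` for `t ≤ 1/4`, `G t = 0` for `t ≥ 1/2`. [folklore] -/
def G (t : ℝ) : ℝ := t * Real.smoothTransition (2 - 4 * t)

/-- `G` is smooth. [folklore] -/
theorem G_contDiff : ContDiff ℝ ∞ G :=
  contDiff_id.mul (Real.smoothTransition.contDiff.comp
    (contDiff_const.sub (contDiff_const.mul contDiff_id)))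

/-- `G = id` on `(-∞, 1/4]`. [folklore] -/
theorem G_eq_self {t : ℝ} (ht : t ≤ 1 / 4) : G t = t := by
  unfold G; rw [Real.smoothTransition.one_of_one_le (by linarith), mul_one]

/-- `G = 0` on `[1/2, ∞)`. [folklore] -/
theorem G_eq_zero {t : ℝ} (ht : 1 / 2 ≤ t) : G t = 0 := by
  unfold G; rw [Real.smoothTransition.zero_of_nonpos (by linarith), mul_zero]

/-- `G'` is smooth. [folklore] -/
theorem dG_contDiff : ContDiff ℝ ∞ (deriv G) := (contDiff_infty_iff_deriv.1 G_contDiff).2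

/-- `G''` is smooth. [folklore] -/
theorem ddG_contDiff : ContDiff ℝ ∞ (deriv (deriv G)) := (contDiff_infty_iff_deriv.1 dG_contDiff).2

/-- `G` is differentiable. [folklore] -/
theorem G_differentiable : Differentiable ℝ G := G_contDiff.differentiable (by simp)

/-- `G'` is differentiable. [folklore] -/
theorem dG_differentiable : Differentiable ℝ (deriv G) := dG_contDiff.differentiable (by simp)

/-- `G' = 1` on `t < 1/4`. [folklore] -/
theorem dG_eq_one {t : ℝ} (ht : t < 1 / 4) : deriv G t = 1 := by
  have h : G =ᶠ[𝓝 t] id := by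
    filter_upwards [Iio_mem_nhds ht] with s hs using G_eq_self hs.le
  rw [h.deriv_eq, deriv_id]

/-- `G'' = 0` on `t < 1/4`. [folklore] -/
theorem ddG_eq_zero {t : ℝ} (ht : t < 1 / 4) : deriv (deriv G) t = 0 := by
  have h : deriv G =ᶠ[𝓝 t] fun _ => (1 : ℝ) := by
    filter_upwards [Iio_mem_nhds ht] with s hs using dG_eq_one hs
  rw [h.deriv_eq, deriv_const]

/-- `G' = 0` on `t > 1/2`. [folklore] -/
theorem dG_eq_zero {t : ℝ} (ht : 1 / 2 < t) : deriv G t = 0 := by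
  have h : G =ᶠ[𝓝 t] fun _ => (0 : ℝ) := by
    filter_upwards [Ioi_mem_nhds ht] with s hs using G_eq_zero hs.le
  rw [h.deriv_eq, deriv_const]

/-- The poloidal ring field (explicitly): `w = (−2x₀x₂G'(s), −2x₁x₂G'(s), 2G(s) + 2(x₀²+x₁²)G'(s))`,
`s = ‖x‖²` — the curl of the azimuthal potential `G(s)·(−x₁, x₀, 0)`; divergence free with purely
horizontal (azimuthal) vorticity `curl w = (10G'(s) + 4sG''(s))·(x₁, −x₀, 0)`. [folklore] -/
def w (x : E3) : E3 :=
  WithLp.toLp 2 ![-2 * x 0 * x 2 * deriv G (‖x‖ ^ 2), -2 * x 1 * x 2 * deriv G (‖x‖ ^ 2),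
    2 * G (‖x‖ ^ 2) + 2 * (x 0 ^ 2 + x 1 ^ 2) * deriv G (‖x‖ ^ 2)]

/-- First component of `w`. [folklore] -/
theorem w_apply_zero (x : E3) : w x 0 = (-2 * x 0 * x 2) * deriv G (‖x‖ ^ 2) := by simp [w]
/-- Second component of `w`. [folklore] -/
theorem w_apply_one (x : E3) : w x 1 = (-2 * x 1 * x 2) * deriv G (‖x‖ ^ 2) := by simp [w]
/-- Third component of `w`. [folklore] -/
theorem w_apply_two (x : E3) :
    w x 2 = 2 * G (‖x‖ ^ 2) + (2 * (x 0 ^ 2 + x 1 ^ 2)) * deriv G (‖x‖ ^ 2) := by simp [w]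

/-- `w₀` is smooth. [folklore] -/
private theorem contDiff_w0 : ContDiff ℝ ∞ (fun x => w x 0) := by
  rw [show (fun x => w x 0) = fun x : E3 => (-2 * x 0 * x 2) * deriv G (‖x‖ ^ 2) from
    funext w_apply_zero]
  exact ((contDiff_const.mul (contDiff_coord 0)).mul (contDiff_coord 2)).mul
    (dG_contDiff.comp (contDiff_norm_sq ℝ))

/-- `w₁` is smooth. [folklore] -/
private theorem contDiff_w1 : ContDiff ℝ ∞ (fun x => w x 1) := by
  rw [show (fun x => w x 1) = fun x : E3 => (-2 * x 1 * x 2) * deriv G (‖x‖ ^ 2) from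
    funext w_apply_one]
  exact ((contDiff_const.mul (contDiff_coord 1)).mul (contDiff_coord 2)).mul
    (dG_contDiff.comp (contDiff_norm_sq ℝ))

/-- `w₂` is smooth. [folklore] -/
private theorem contDiff_w2 : ContDiff ℝ ∞ (fun x => w x 2) := by
  rw [show (fun x => w x 2) = fun x : E3 =>
      2 * G (‖x‖ ^ 2) + (2 * (x 0 ^ 2 + x 1 ^ 2)) * deriv G (‖x‖ ^ 2) from funext w_apply_two]
  exact (contDiff_const.mul (G_contDiff.comp (contDiff_norm_sq ℝ))).add
    ((contDiff_const.mul (((contDiff_coord 0).pow 2).add ((contDiff_coord 1).pow 2))).mul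
      (dG_contDiff.comp (contDiff_norm_sq ℝ)))

/-- `w` is smooth. [folklore] -/
theorem w_contDiff : ContDiff ℝ ∞ w := by
  rw [contDiff_euclidean]
  intro i
  fin_cases i
  exacts [contDiff_w0, contDiff_w1, contDiff_w2]

/-- `w` is differentiable. [folklore] -/
theorem w_differentiable : Differentiable ℝ w := w_contDiff.differentiable (by simp)

/-- `w = 0` where `‖x‖² > 1/2`. [folklore] -/
theorem w_eq_zero {x : E3} (hx : 1 / 2 < ‖x‖ ^ 2) : w x = 0 := by
  ext i
  fin_cases i <;> simp [w, G_eq_zero hx.le, dG_eq_zero hx]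

/-- `w` is supported in the closed unit ball. [folklore] -/
theorem w_hasCompactSupport : HasCompactSupport w := by
  refine HasCompactSupport.intro (ProperSpace.isCompact_closedBall (0 : E3) 1) fun x hx => ?_
  refine w_eq_zero ?_
  rw [Metric.mem_closedBall, dist_zero_right, not_le] at hx
  nlinarith [norm_nonneg x]

/-- Off the closed ball of radius `√(1/2)`, `Dw = 0`. [folklore] -/
theorem fderiv_w_eq_zero {x : E3} (hx : 1 / 2 < ‖x‖ ^ 2) : fderiv ℝ w x = 0 := by
  have h : w =ᶠ[𝓝 x] fun _ => (0 : E3) := by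
    have ho : IsOpen {y : E3 | 1 / 2 < ‖y‖ ^ 2} :=
      isOpen_lt continuous_const (continuous_norm.pow 2)
    filter_upwards [ho.mem_nhds hx] with y hy using w_eq_zero hy
  rw [h.fderiv_eq]; simp

/-- Off the closed ball of radius `√(1/2)`, `curl w = 0`. [folklore] -/
theorem curl_w_eq_zero {x : E3} (hx : 1 / 2 < ‖x‖ ^ 2) : curl w x = 0 :=
  curl_eq_zero_of_fderiv_eq_zero (fderiv_w_eq_zero hx)

/-- `Dw₀ = −2x₂G'·dx₀ − 2x₀G'·dx₂ − 4x₀x₂G''·⟪x, ·⟫`. [folklore] -/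
theorem hasFDerivAt_w0 (x : E3) :
    HasFDerivAt (fun y => w y 0)
      ((-2 * x 2 * deriv G (‖x‖ ^ 2)) • (EuclideanSpace.proj 0 : E3 →L[ℝ] ℝ) +
        (-2 * x 0 * deriv G (‖x‖ ^ 2)) • (EuclideanSpace.proj 2 : E3 →L[ℝ] ℝ) +
        (-4 * x 0 * x 2 * deriv (deriv G) (‖x‖ ^ 2)) • innerSL ℝ x) x := by
  have h : HasFDerivAt (fun y : E3 => -2 * y 0 * y 2 * deriv G (‖y‖ ^ 2)) _ x :=
    (((hasFDerivAt_coord 0 x).const_mul (-2)).mul (hasFDerivAt_coord 2 x)).mul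
      (hasFDerivAt_radial ((dG_differentiable _).hasDerivAt))
  refine (h.congr_fderiv ?_).congr_of_eventuallyEq (Eventually.of_forall fun y => w_apply_zero y)
  ext h
  simp
  ring

/-- `Dw₁ = −2x₂G'·dx₁ − 2x₁G'·dx₂ − 4x₁x₂G''·⟪x, ·⟫`. [folklore] -/
theorem hasFDerivAt_w1 (x : E3) :
    HasFDerivAt (fun y => w y 1)
      ((-2 * x 2 * deriv G (‖x‖ ^ 2)) • (EuclideanSpace.proj 1 : E3 →L[ℝ] ℝ) +
        (-2 * x 1 * deriv G (‖x‖ ^ 2)) • (EuclideanSpace.proj 2 : E3 →L[ℝ] ℝ) +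
        (-4 * x 1 * x 2 * deriv (deriv G) (‖x‖ ^ 2)) • innerSL ℝ x) x := by
  have h : HasFDerivAt (fun y : E3 => -2 * y 1 * y 2 * deriv G (‖y‖ ^ 2)) _ x :=
    (((hasFDerivAt_coord 1 x).const_mul (-2)).mul (hasFDerivAt_coord 2 x)).mul
      (hasFDerivAt_radial ((dG_differentiable _).hasDerivAt))
  refine (h.congr_fderiv ?_).congr_of_eventuallyEq (Eventually.of_forall fun y => w_apply_one y)
  ext h
  simp
  ring

/-- `Dw₂ = 4x₀G'·dx₀ + 4x₁G'·dx₁ + (4G' + 4(x₀²+x₁²)G'')·⟪x, ·⟫`. [folklore] -/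
theorem hasFDerivAt_w2 (x : E3) :
    HasFDerivAt (fun y => w y 2)
      ((4 * x 0 * deriv G (‖x‖ ^ 2)) • (EuclideanSpace.proj 0 : E3 →L[ℝ] ℝ) +
        (4 * x 1 * deriv G (‖x‖ ^ 2)) • (EuclideanSpace.proj 1 : E3 →L[ℝ] ℝ) +
        (4 * deriv G (‖x‖ ^ 2) + 4 * (x 0 ^ 2 + x 1 ^ 2) * deriv (deriv G) (‖x‖ ^ 2)) •
          innerSL ℝ x) x := by
  have h : HasFDerivAt
      (fun y : E3 => 2 * G (‖y‖ ^ 2) + 2 * (y 0 ^ 2 + y 1 ^ 2) * deriv G (‖y‖ ^ 2)) _ x :=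
    ((hasFDerivAt_radial ((G_differentiable _).hasDerivAt)).const_mul 2).add
      (((((hasFDerivAt_coord 0 x).pow 2).add ((hasFDerivAt_coord 1 x).pow 2)).const_mul 2).mul
        (hasFDerivAt_radial ((dG_differentiable _).hasDerivAt)))
  refine (h.congr_fderiv ?_).congr_of_eventuallyEq (Eventually.of_forall fun y => w_apply_two y)
  ext h
  simp
  ring

/-- `w` is differentiable at every point, componentwise form used for `fderiv_apply_coord`. -/
theorem pd_w (x : E3) (i j : Fin 3) :
    fderiv ℝ w x (EuclideanSpace.single j 1) i =
      fderiv ℝ (fun y => w y i) x (EuclideanSpace.single j 1) :=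
  fderiv_apply_coord (w_differentiable x) _ i

/-- `div w = 0`. [folklore] -/
theorem divergence_w (x : E3) : NSWave0.divergence w x = 0 := by
  change VectorCalculus.divergence w x = 0
  rw [divergence_eq_sum_inner_fderiv (EuclideanSpace.basisFun (Fin 3) ℝ), Fin.sum_univ_three]
  simp only [EuclideanSpace.basisFun_apply, EuclideanSpace.inner_single_left, map_one, one_mul]
  rw [pd_w, pd_w, pd_w, (hasFDerivAt_w0 x).fderiv, (hasFDerivAt_w1 x).fderiv, (hasFDerivAt_w2 x).fderiv]
  simp [EuclideanSpace.inner_single_right]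
  ring

/-- The vorticity of `w` is horizontal: `(curl w)₂ = 0`. [folklore] -/
theorem curl_w_apply_two (x : E3) : curl w x 2 = 0 := by
  simp only [curl, PiLp.toLp_apply, Matrix.cons_val_two, Matrix.tail_cons, Matrix.head_cons]
  rw [pd_w, pd_w, (hasFDerivAt_w0 x).fderiv, (hasFDerivAt_w1 x).fderiv]
  simp [EuclideanSpace.inner_single_right]
  ring

/-- `(curl w)₁ = −x₀ (10 G'(s) + 4 s G''(s))`. [folklore] -/
theorem curl_w_apply_one (x : E3) :
    curl w x 1 = -(x 0 * (10 * deriv G (‖x‖ ^ 2) + 4 * ‖x‖ ^ 2 * deriv (deriv G) (‖x‖ ^ 2))) := by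
  simp only [curl, PiLp.toLp_apply, Matrix.cons_val_one]
  rw [pd_w, pd_w, (hasFDerivAt_w0 x).fderiv, (hasFDerivAt_w2 x).fderiv]
  simp [EuclideanSpace.inner_single_right, normsq_eq]
  ring

/-- The axisymmetric strain `D = diag(1, 1, −2)` as a continuous linear map. [folklore] -/
def Dlin : E3 →L[ℝ] E3 :=
  (EuclideanSpace.proj (0 : Fin 3) : E3 →L[ℝ] ℝ).smulRight (EuclideanSpace.single 0 1) +
  (EuclideanSpace.proj (1 : Fin 3) : E3 →L[ℝ] ℝ).smulRight (EuclideanSpace.single 1 1) -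
  (2 : ℝ) • (EuclideanSpace.proj (2 : Fin 3) : E3 →L[ℝ] ℝ).smulRight (EuclideanSpace.single 2 1)

/-- `D h = (h₀, h₁, −2h₂)`. [folklore] -/
theorem Dlin_apply (h : E3) (k : Fin 3) : Dlin h k = ![h 0, h 1, -2 * h 2] k := by
  fin_cases k <;> simp [Dlin]

/-- A linear symmetric field has no curl: `curl (D x) = 0`. [folklore] -/
theorem curl_Dlin (x : E3) : curl (fun y => Dlin y) x = 0 := by
  have : fderiv ℝ (fun y => Dlin y) x = Dlin := Dlin.fderiv
  ext k
  fin_cases k <;> simp [curl, this, Dlin_apply]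

/-- `⟪D ω, ω⟫ = ‖ω‖²` for HORIZONTAL `ω` (`ω₂ = 0`): the strain stretches azimuthal vorticity at unit rate. [folklore] -/
theorem inner_Dlin_of_horizontal {b : E3} (h : b 2 = 0) : ⟪Dlin b, b⟫ = ‖b‖ ^ 2 := by
  rw [inner_eq3, normsq_eq]
  simp [Dlin_apply, h]
  ring

/-- The vector potential `A x = x₂ (x₁, −x₀, 0)` of the linear strain. [folklore] -/
def A (x : E3) : E3 := WithLp.toLp 2 ![x 2 * x 1, -(x 2 * x 0), 0]

/-- First component of `A`. [folklore] -/
theorem A_apply_zero (x : E3) : A x 0 = x 2 * x 1 := by simp [A]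
/-- Second component of `A`. [folklore] -/
theorem A_apply_one (x : E3) : A x 1 = -(x 2 * x 0) := by simp [A]
/-- Third component of `A`. [folklore] -/
theorem A_apply_two (x : E3) : A x 2 = 0 := by simp [A]

/-- `A₀` is smooth. [folklore] -/
private theorem contDiff_A0 : ContDiff ℝ ∞ (fun x => A x 0) := by
  rw [show (fun x => A x 0) = fun x : E3 => x 2 * x 1 from funext A_apply_zero]
  exact (contDiff_coord 2).mul (contDiff_coord 1)

/-- `A₁` is smooth. [folklore] -/
private theorem contDiff_A1 : ContDiff ℝ ∞ (fun x => A x 1) := by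
  rw [show (fun x => A x 1) = fun x : E3 => -(x 2 * x 0) from funext A_apply_one]
  exact ((contDiff_coord 2).mul (contDiff_coord 0)).neg

/-- `A₂` is smooth. [folklore] -/
private theorem contDiff_A2 : ContDiff ℝ ∞ (fun x => A x 2) := by
  rw [show (fun x => A x 2) = fun _ : E3 => (0 : ℝ) from funext A_apply_two]
  exact contDiff_const

/-- `A` is smooth. [folklore] -/
theorem A_contDiff : ContDiff ℝ ∞ A := by
  rw [contDiff_euclidean]
  intro i
  fin_cases i
  exacts [contDiff_A0, contDiff_A1, contDiff_A2]

/-- `A` is differentiable. [folklore] -/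
theorem A_differentiable : Differentiable ℝ A := A_contDiff.differentiable (by simp)

/-- `DA₀ = x₂ dx₁ + x₁ dx₂`. [folklore] -/
private theorem hasFDerivAt_A0 (x : E3) : HasFDerivAt (fun y => A y 0)
    (x 2 • (EuclideanSpace.proj 1 : E3 →L[ℝ] ℝ) + x 1 • (EuclideanSpace.proj 2 : E3 →L[ℝ] ℝ)) x :=
  ((hasFDerivAt_coord 2 x).mul (hasFDerivAt_coord 1 x)).congr_of_eventuallyEq
    (Eventually.of_forall fun y => A_apply_zero y)

/-- `DA₁ = −(x₂ dx₀ + x₀ dx₂)`. [folklore] -/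
private theorem hasFDerivAt_A1 (x : E3) : HasFDerivAt (fun y => A y 1)
    (-(x 2 • (EuclideanSpace.proj 0 : E3 →L[ℝ] ℝ) + x 0 • (EuclideanSpace.proj 2 : E3 →L[ℝ] ℝ))) x :=
  ((hasFDerivAt_coord 2 x).mul (hasFDerivAt_coord 0 x)).neg.congr_of_eventuallyEq
    (Eventually.of_forall fun y => A_apply_one y)

/-- `DA₂ = 0`. [folklore] -/
private theorem hasFDerivAt_A2 (x : E3) : HasFDerivAt (fun y => A y 2) (0 : E3 →L[ℝ] ℝ) x :=
  (hasFDerivAt_const (0 : ℝ) x).congr_of_eventuallyEq (Eventually.of_forall fun y => A_apply_two y)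

/-- `curl A = D x`. [folklore] -/
theorem curl_A (x : E3) : curl A x = Dlin x := by
  ext k
  fin_cases k
  · simp [curl, fderiv_apply_coord (A_differentiable x), (hasFDerivAt_A1 x).fderiv,
      (hasFDerivAt_A2 x).fderiv, Dlin_apply]
  · simp [curl, fderiv_apply_coord (A_differentiable x), (hasFDerivAt_A0 x).fderiv,
      (hasFDerivAt_A2 x).fderiv, Dlin_apply]
  · simp [curl, fderiv_apply_coord (A_differentiable x), (hasFDerivAt_A0 x).fderiv,
      (hasFDerivAt_A1 x).fderiv, Dlin_apply]
    ring

/-- The cut-off: a smooth bump `≡ 1` on the closed unit ball, supported in the ball of radius `2`. -/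
def χ : ContDiffBump (0 : E3) := ⟨1, 2, one_pos, one_lt_two⟩

/-- The compactly supported potential `Φ = χ · A`. [folklore] -/
def Φ (x : E3) : E3 := (χ : E3 → ℝ) x • A x

/-- The strain cavity field `v = curl Φ`: smooth, compactly supported, divergence free, and equal to the
linear strain `D x` on the unit ball (where `χ ≡ 1`). [folklore] -/
def v : E3 → E3 := curl Φ

/-- `Φ` is smooth. [folklore] -/
theorem Φ_contDiff : ContDiff ℝ ∞ Φ := χ.contDiff.smul A_contDiff

/-- `Φ` has compact support. [folklore] -/
theorem Φ_hasCompactSupport : HasCompactSupport Φ :=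
  χ.hasCompactSupport.mono fun x hx => by
    contrapose! hx
    simp [Φ, Function.notMem_support.1 hx]

/-- `v` is smooth. [folklore] -/
theorem v_contDiff : ContDiff ℝ ∞ v :=
  contDiff_curl (n := ⊤) (Φ_contDiff.of_le (by exact_mod_cast le_top))

/-- `v` is differentiable. [folklore] -/
theorem v_differentiable : Differentiable ℝ v := v_contDiff.differentiable (by simp)

/-- `v` has compact support. [folklore] -/
theorem v_hasCompactSupport : HasCompactSupport v := hasCompactSupport_curl Φ_hasCompactSupport

/-- `div v = div curl Φ = 0`. [folklore] -/
theorem divergence_v (x : E3) : NSWave0.divergence v x = 0 := by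
  change VectorCalculus.divergence (curl Φ) x = 0
  exact divergence_curl_eq_zero_holds Φ (contDiff_infty.1 Φ_contDiff 2) x

/-- On the open unit ball, `v = D x`. [folklore] -/
theorem v_eq_Dlin {x : E3} (hx : ‖x‖ < 1) : v x = Dlin x := by
  have h : Φ =ᶠ[𝓝 x] A := by
    filter_upwards [Metric.isOpen_ball.mem_nhds (mem_ball_zero_iff.2 hx)] with y hy
    rw [Φ, χ.one_of_mem_closedBall (Metric.ball_subset_closedBall (by simpa [χ] using hy)), one_smul]
  show curl Φ x = Dlin x
  rw [curl_eq_curlCLM, h.fderiv_eq, ← curl_eq_curlCLM, curl_A]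

/-- On the open unit ball, `v` agrees with `D x` near every point. [folklore] -/
theorem v_eventuallyEq {x : E3} (hx : ‖x‖ < 1) : v =ᶠ[𝓝 x] fun y => Dlin y := by
  filter_upwards [Metric.isOpen_ball.mem_nhds (mem_ball_zero_iff.2 hx)] with y hy
    using v_eq_Dlin (mem_ball_zero_iff.1 hy)

/-- On the open unit ball, `Dv = D`. [folklore] -/
theorem fderiv_v {x : E3} (hx : ‖x‖ < 1) : fderiv ℝ v x = Dlin := by
  rw [(v_eventuallyEq hx).fderiv_eq]; exact Dlin.fderiv

/-- On the open unit ball, `curl v = 0`. [folklore] -/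
theorem curl_v {x : E3} (hx : ‖x‖ < 1) : curl v x = 0 := by
  rw [curl_eq_curlCLM, (v_eventuallyEq hx).fderiv_eq, ← curl_eq_curlCLM]; exact curl_Dlin x

end Summit.NavierStokesRegularity.NavierStokesRegularity.Theorems.Bledsoe2026

end
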